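import Summits.ResolutionOfSingularities.ResolutionOfSingularities.Theorems.FrobeniusClosingSteerPersistentExceptional
import Summits.ResolutionOfSingularities.ResolutionOfSingularities.Theorems.FrobeniusClosingSteerRsopMonomialStep
import Literature.AlgebraicGeometry.Resolution.BlowupDimension
import Literature.AlgebraicGeometry.Resolution.ShannonHullParameter
import Mathlib.Data.Set.Finite.Basic
import HarnessLib

/-!
# Crux `Steer` (stmt-ResolutionOfSingularities-16345), chain W4.1 — **HLOST Prop. 3.8 IS A THEOREM: `HeinzerEtAl2015HullParameterExists_holds`**
# (a Shannon extension along a dominating valuation ring has a hull parameter)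

OURS (campaign `res-hironaka`, rung L ★L-G4, slot W4.1; seat res-type-028 on res-L0-w41-plan-1 RULING 69a «discharge the named fact
`Literature.AlgebraicGeometry.Resolution.HeinzerEtAl2015HullParameterExists` (p521233) first»; NOT a statement of the manuscript
under review [claim: Hironaka2017, status: under-review]; AI-produced, weaker than expert review).  Theses-free, definition-free;
discharges the Literature fact from the `Theorems/` side (the gate's facts probe runs on both trees).

THE PROOF (elementary along the valuation; Heinzer–Loper–Olberding–Schoutens–Toeniskoetter, arXiv:1505.06445, Prop. 2.8 +
Prop. 3.8, without essential-prime-divisor theory).  Along the sequence choose EXCEPTIONAL PARAMETERS `x j ∈ R j` (nonzero of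
positive value, regular parameters, `𝔪_j ⊆ x_j R (j+1)`; `Hull.exists_excParam`).  An index `k` is DEAD at stage `j` if `x k`
divides a power of `x (k+1)` in `R j`; by `Hull.card_notDead_le_ringKrullDim` (companion file, HLOST Prop. 2.8) at most `dim R j`
indices below `j − 1` are not dead at `j`.  Here: (1) **`ringKrullDim_le_of_isQuadraticTransformAlong`** — the Krull dimension does
not grow along a quadratic transform of a regular local ring (Matsumura 15.5 for the birational blow-up chart, via the tree's Rees
chart `chartRing` / `chartCentre` / `locToField` and `BlowupDimension.ringKrullDim_localization_chartRing_le`), hence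
`dim R j ≤ dim R 0` for all `j`; (2) so the set of ETERNAL indices (dead at no stage) is finite — every finite subset has at most
`dim R 0` elements; (3) past the last eternal index `i`, every `k ≥ i` dies somewhere, so `x j ^ m / x i ∈ S` for all `j ≥ i`
(`Hull.pow_div_mem_shannonExt_of_dead`) and every `a ∈ S` of positive value, being `x j`-divisible in `R (j+1)` for large `j`, has a
power in `x i · S`: `x i S` is `N`-primary, `x i` is a regular parameter of `R i` with `𝔪_i ⊆ x_i R (i+1)` — HLOST Prop. 3.8 verbatim in
the typed shape of `HeinzerEtAl2015HullParameterExists`.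

Sources: [HeinzerEtAl2015] Lemma 2.7, Prop. 2.8, Prop. 3.8; [Matsumura1987] Thm. 15.5; [Cutkosky2014] §2.2.  No named facts used,
no `sorry`.
-/

noncomputable section

-- `Summit.<S>.<S>.…` duplicates the summit name by design (single-problem summit).
set_option linter.dupNamespace false
set_option autoImplicit false

namespace Summit.ResolutionOfSingularities.ResolutionOfSingularities.Theorems.SwitchingDichotomy.Hull

open IsLocalRing
open Literature.AlgebraicGeometry.Resolution
open Summit.ResolutionOfSingularities.ResolutionOfSingularities.Theorems.SwitchingDichotomy
  (exists_ringEquiv_of_range_eq_rsopStep locToField_injective_rsopStep)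

variable {K : Type} [Field K]

/-! ## The Krull dimension does not grow along a quadratic transform -/

/-- **`dim R₁ ≤ dim R` for the quadratic transform `R₁` of a regular local ring `R ⊆ O` along `O`** (Matsumura Thm. 15.5 for the
birational chart `R[𝔪/x_i] ⊆ Frac R`): `R₁` is the localisation at the centre of `O` of the Rees chart `R[(x)/x_i]` of a regular
system of parameters `x` at a member `x_i` of maximal value (uniqueness of the transform), identified with the abstract chart
`chartRing x i` through `locToField` (injective with image `R₁`), where the tree's `ringKrullDim_localization_chartRing_le` applies.
[cite: Matsumura1987, Thm. 15.5] [cite: HeinzerEtAl2015, Remark 2.9] -/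
theorem ringKrullDim_le_of_isQuadraticTransformAlong (R : Subring K) [IsRegularLocalRing R] (O : ValuationSubring K)
    (hdom : SubringDominates R O.toSubring) (R₁ : Subring K) (h : IsQuadraticTransformAlong O R R₁) :
    ringKrullDim R₁ ≤ ringKrullDim R := by
  classical
  have hRO := h.source_le
  obtain ⟨x, hx⟩ := exists_regularSystemOfParameters (R := R)
  obtain ⟨_, x₀, hx₀m, hx₀0, -, -⟩ := h.exists_eq_locAtCentre
  -- some parameter is nonzero (as `𝔪_R ≠ 0`)
  have hne : ∃ j ∈ (Finset.univ : Finset (Fin (maximalIdeal R).spanFinrank)), ((x j : R) : K) ≠ 0 := by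
    by_contra hcon
    have hall : ∀ j, x j = 0 := fun j => by
      by_contra hj
      exact hcon ⟨j, Finset.mem_univ j, fun h0 => hj (Subtype.ext h0)⟩
    have hbot : Ideal.span (Set.range x) = ⊥ := by
      rw [Ideal.span_eq_bot]
      rintro _ ⟨j, rfl⟩
      exact hall j
    rw [hx] at hbot
    rw [hbot] at hx₀m
    exact hx₀0 ((Submodule.mem_bot _).mp hx₀m)
  obtain ⟨i, -, hi0, hmax⟩ := exists_max_valuation O Finset.univ (fun j => ((x j : R) : K)) hne
  have hxi : x i ≠ 0 := fun h0 => hi0 (by rw [h0]; rfl)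
  -- `R₁` is the transform in the `x_i`-chart
  have hspan : Ideal.span (↑(Finset.univ.image x) : Set R) = maximalIdeal R := by
    rw [Finset.coe_image, Finset.coe_univ, Set.image_univ, hx]
  have h' : IsQuadraticTransformAlong O R (locAtCentre (blowupRing R (x i : K)) O) := by
    refine ⟨‹_›, hRO, Finset.univ.image x, x i, hspan, Finset.mem_image_of_mem x (Finset.mem_univ i),
      hxi, ?_, ?_⟩
    · intro y hy
      obtain ⟨j, -, rfl⟩ := Finset.mem_image.mp hy
      exact hmax j (Finset.mem_univ j)
    · rw [blowupRing_eq_closure_of_span_eq (x i : K) _ hspan]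
  have hR₁ : R₁ = locAtCentre (blowupRing R (x i : K)) O := h.unique h'
  -- the abstract Rees chart, its centre, and the isomorphism `θ_L : B_N ≅ R₁`
  have hθ : R.subtype (x i) ≠ 0 := hi0
  have hRO' : ∀ r : R, R.subtype r ∈ O := fun r => hRO r.2
  have hmin' : ∀ j, O.valuation (R.subtype (x j)) ≤ O.valuation (R.subtype (x i)) :=
    fun j => hmax j (Finset.mem_univ j)
  have hdom' : ∀ r ∈ maximalIdeal R, O.valuation (R.subtype r) < 1 := fun r hr =>
    ((subringDominates_valuationSubring_iff hRO).mp hdom r).mp hr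
  set N := chartCentre x i R.subtype hθ O hRO' hmin' with hN
  have hNm : N.comap (chartBase x i) = maximalIdeal R :=
    comap_reesChartBase_chartCentre x i R.subtype hθ O hRO' hmin' hdom'
  set f := locToField x i R.subtype hθ O hRO' hmin' (Localization.AtPrime N) with hf
  have hfinj : Function.Injective f :=
    locToField_injective_rsopStep x i R.subtype hθ Subtype.val_injective O hRO' hmin' _
  have hrange : f.range = R₁ := by
    rw [hR₁, hf, range_locToField,
      range_chartToField_eq_blowupRing x i R.subtype hθ hx R (Subring.range_subtype R)]
    rfl
  obtain ⟨e, -⟩ := exists_ringEquiv_of_range_eq_rsopStep f hfinj R₁ hrange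
  rw [← ringKrullDim_eq_of_ringEquiv e]
  exact ringKrullDim_localization_chartRing_le x i N hNm (Localization.AtPrime N)

/-- Along a sequence of quadratic transforms of a regular local ring along a dominating valuation ring, the Krull dimension of the
members is bounded by that of the first one. [cite: HeinzerEtAl2015, Remark 2.9] [folklore] -/
theorem ringKrullDim_sequence_le {O : ValuationSubring K} {R : ℕ → Subring K} (hreg : IsRegularLocalRing (R 0))
    (hdom : SubringDominates (R 0) O.toSubring) (hstep : ∀ i, IsQuadraticTransformAlong O (R i) (R (i + 1))) (j : ℕ) :
    ringKrullDim (R j) ≤ ringKrullDim (R 0) := by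
  induction j with
  | zero => exact le_rfl
  | succ j ih =>
    haveI : IsRegularLocalRing (R j) := isRegularLocalRing_sequence hreg hstep j
    exact (ringKrullDim_le_of_isQuadraticTransformAlong (R j) O (sequence_dominates hdom hstep j).1 (R (j + 1))
      (hstep j)).trans ih

/-! ## HLOST Prop. 3.8 -/

/-- **HLOST Proposition 3.8 is a theorem** — discharge of the named fact `HeinzerEtAl2015HullParameterExists` (p521233): along an
infinite sequence of quadratic transforms of regular local rings of dimension `≥ 2` along a dominating valuation ring `O`, some
member `R i` carries a regular parameter `x` with `𝔪_i ⊆ x R (i+1)` and `x S` primary for the maximal ideal of the Shannon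
extension `S = ⋃ R j`.  Proof: exceptional parameters (`exists_excParam`); finitely many eternal indices (`card_notDead_le_ringKrullDim`
+ `ringKrullDim_sequence_le`); past them every positive-value element of `S` has a power divisible by `x i`
(`pow_div_mem_shannonExt_of_dead`).  (The dimension hypothesis of Setting 3.1 is not even used.) OURS.
[cite: HeinzerEtAl2015, Prop. 3.8] [cite: HeinzerEtAl2015, Prop. 2.8] -/
theorem heinzerEtAl2015HullParameterExists_holds : HeinzerEtAl2015HullParameterExists.{0} := by
  intro K _ O R hreg0 _hdim2 hdom0 hstep
  classical
  have hRreg : ∀ i, IsRegularLocalRing (R i) := isRegularLocalRing_sequence hreg0 hstep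
  have hRdom : ∀ i, SubringDominates (R i) O.toSubring := fun i => (sequence_dominates hdom0 hstep i).1
  have hmono : Monotone R := sequence_monotone hstep
  -- exceptional parameters
  have hex : ∀ j, ∃ x : K, ∃ hxR : x ∈ R j, x ≠ 0 ∧ O.valuation x < 1 ∧
      IsRsopPart (fun _ : Fin 1 => (⟨x, hxR⟩ : R j)) ∧ ∀ y : K, y ∈ R j → O.valuation y < 1 → y / x ∈ R (j + 1) :=
    fun j => exists_excParam (hRdom j) (hstep j)
  choose x hxR hx0 hxv hxrsop hxdiv using hex
  -- a uniform dimension bound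
  set d : ℕ := (maximalIdeal (R 0)).spanFinrank with hd
  have hdim0 : ringKrullDim (R 0) = (d : WithBot ℕ∞) := (IsRegularLocalRing.spanFinrank_maximalIdeal (R := R 0)).symm
  have hdimj : ∀ j, ringKrullDim (R j) ≤ (d : WithBot ℕ∞) := fun j =>
    (ringKrullDim_sequence_le hreg0 hdom0 hstep j).trans hdim0.le
  -- the eternal indices form a finite set: every finite subset has at most `d` elements
  set E : Set ℕ := {k | ∀ (j m : ℕ), x (k + 1) ^ m / x k ∉ R j} with hE
  have hEcard : ∀ F : Finset ℕ, (↑F : Set ℕ) ⊆ E → F.card ≤ d := by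
    intro F hF
    -- a stage beyond all of `F`
    set j : ℕ := F.sup id + 2 with hj
    have hFj : ∀ k ∈ F, k + 1 < j := by
      intro k hk
      have : k ≤ F.sup id := Finset.le_sup (f := id) hk
      omega
    have hnd : ∀ k ∈ F, ∀ m : ℕ, x (k + 1) ^ m / x k ∉ R j := fun k hk m => hF (Finset.mem_coe.mpr hk) j m
    have h := card_notDead_le_ringKrullDim hRreg hRdom hstep x hxR hx0 hxv hxdiv (hxrsop 0) j F hFj hnd
    exact_mod_cast h.trans (hdimj j)
  have hEfin : E.Finite := by
    by_contra hinf
    obtain ⟨F, hFE, hFcard⟩ := Set.Infinite.exists_subset_card_eq hinf (d + 1)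
    have := hEcard F hFE
    omega
  -- an index past every eternal one
  obtain ⟨B, hB⟩ := hEfin.bddAbove
  set i : ℕ := B + 1 with hi
  have hdead : ∀ k, i ≤ k → ∃ (j m : ℕ), x (k + 1) ^ m / x k ∈ R j := by
    intro k hk
    by_contra hcon
    push Not at hcon
    have hkE : k ∈ E := hcon
    have := hB hkE
    omega
  -- the hull parameter is `x i`
  refine ⟨i, x i, inferInstance, fun _ => ⟨x i, hxR i⟩, hxrsop i, rfl, hxdiv i, ?_⟩
  intro a ha hva
  -- `a ∈ R j'` for some `j' ≥ i + 1`, so `a / x j' ∈ R (j' + 1)`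
  obtain ⟨j₀, hj₀⟩ := (Subring.mem_iSup_of_directed hmono.directed_le).mp ha
  set j' : ℕ := max j₀ (i + 1) with hj'
  have haj' : a ∈ R j' := hmono (le_max_left _ _) hj₀
  have hij' : i ≤ j' := (Nat.le_succ i).trans (le_max_right _ _)
  have hq : a / x j' ∈ R (j' + 1) := hxdiv j' a haj' hva
  -- `x j' ^ M / x i ∈ S` since every index in `[i, j')` dies
  obtain ⟨M, hM⟩ := pow_div_mem_shannonExt_of_dead x hx0 hij' (fun k hik _ => hdead k hik)
  have hxj : x j' ≠ 0 := hx0 j'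
  have hxi : x i ≠ 0 := hx0 i
  have hsplit : (a / x j') ^ M * (x j' ^ M / x i) = a ^ M / x i := by
    rw [div_pow, div_mul_div_comm, mul_comm (a ^ M), ← div_mul_div_comm, div_self (pow_ne_zero M hxj), one_mul]
  refine ⟨M, a ^ M / x i, ?_, ?_⟩
  · rw [← hsplit]
    exact Subring.mul_mem _ (Subring.pow_mem _ (le_shannonExt R (j' + 1) hq) M) hM
  · rw [div_mul_cancel₀ _ hxi]

end Summit.ResolutionOfSingularities.ResolutionOfSingularities.Theorems.SwitchingDichotomy.Hull

end
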